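import Summits.Langlands.Langlands.Theorems.IrreducibilityBySelfDualityGaloisRepOfRegularAlgebraicOfWeilTraces
import Literature.NumberTheory.Automorphic.VarmaTheorem1BaseChangeProofs
import Literature.NumberTheory.Automorphic.VarmaProp71TwoN
import Literature.NumberTheory.Automorphic.BaseChangeStrongCuspidalPrime
import HarnessLib

/-!
# `GaloisRepOfRegularAlgebraic` (stmt-Langlands-10785) from its four finest named leaves

Census file of the crux line `Cruxes/GaloisRepOfRegularAlgebraic/Lines/Sketch.lean` (continuation lead
c1, 2026-08-16).  After the line's five provable stubs landed (p97119, p96570, p96757, p96714, p100031)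
and the Literature reduced Varma's Theorem 1 in trace form to the `2n`-dimensional Shimura-variety input
(`Varma2024.theorem1_unramified_traces_of_prop71`, p115556), the crux — lang.S27 verbatim — follows
from exactly four named facts of the tree, none of which has a `_holds`:

* `HarrisLanTaylorThorne2016.corollary627_splitOrUnramified` — HLTT 2016 Cor. 6.27 (rigid cohomology
  of the ordinary locus of the `U(n,n)` Shimura variety; route item stmt-Langlands-15020);
* `Varma2024.prop71_twoN` — Varma 2024 Thm. 5.1 + Prop. 7.1 for the same family `R_{p,ı}(π, N)`
  (its clause (b) is Cor. 6.27 again, under the extra guard `[K:ℚ] = 2 → 2 < n`);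
* `ArthurClozel1989_strongLifting_archimedean` — Arthur–Clozel Ch. 3 Thm. 5.1 at the archimedean
  places (route item stmt-Langlands-15021);
* `ArthurClozel1989_strongLifting_cuspidal` — Arthur–Clozel Ch. 3 Thm. 4.2 (a)/5.1, strong cuspidal
  base change in prime degree (route item stmt-Langlands-15022).

`of_namedLeaves` is that closure, kernel-checked; like its siblings it does NOT import the Theses file
and states the item's text verbatim (the skeleton `Lines/Sketch.lean` checks the same composition
against the route decl by name).  The day the four `_holds` land, the crux closes by
`of_namedLeaves h627_holds prop71_twoN_holds harch_holds hBC_holds`.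

References: M. Harris, K.-W. Lan, R. Taylor, J. Thorne, Res. Math. Sci. 3:37 (2016), Cor. 6.27, Thm. A
[HarrisLanTaylorThorneRMS2016]; I. Varma, Forum Math. Sigma 12 (2024) e21, Thm. 1, Thm. 5.1, Prop. 7.1
[VarmaFMS2024]; J. Arthur, L. Clozel, Ann. of Math. Stud. 120 (1989), Ch. 3 Thms. 4.2, 5.1
[ArthurClozelAMS120].
-/

noncomputable section

set_option linter.dupNamespace false

open scoped MatrixGroups Matrix NumberField Polynomial
open NumberField IsDedekindDomain Field Polynomial
open Literature.NumberTheory.Automorphic Literature.NumberTheory.GaloisRepresentations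
open Literature.NumberTheory.Automorphic.HarrisLanTaylorThorne2016

namespace Summit.Langlands.Langlands.Theorems.GaloisRepOfRegularAlgebraic

/-- **The crux `GaloisRepOfRegularAlgebraic` (lang.S27: Galois representations attached to regular
algebraic cuspidal `π` on `GL_n` over a totally real or CM field, unramified and Satake–Frobenius
compatible at every unramified `v ∤ ℓ`) from its four finest named leaves in the tree**: HLTT Cor. 6.27
(`corollary627_splitOrUnramified`), Varma's Thm. 5.1 + Prop. 7.1 (`Varma2024.prop71_twoN`), and
Arthur–Clozel's archimedean clause and strong cuspidal prime-degree base change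
(`ArthurClozel1989_strongLifting_archimedean`, `ArthurClozel1989_strongLifting_cuspidal`).
Proof: `of_leaves_of_weilTraces` (Thm. A from the first, third and fourth leaf by
`theoremA_existence_of_leaves'`; compatibility at every unramified place from the Weil traces in
non-zero degree by the landed stubs S3–S7 of line `Sketch`) fed with
`Varma2024.theorem1_unramified_traces_of_prop71` (the Weil traces from the second, third and fourth
leaf).  This is the exact present trust base of the crux: four printed theorems, no `sorry`.
[cite: HarrisLanTaylorThorneRMS2016, Cor. 6.27 (p. 225), Thm. A (p. 3)]
[cite: VarmaFMS2024, Thm. 1 (p. 2), Thm. 5.1, Prop. 7.1 (p. 20)]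
[cite: ArthurClozelAMS120, Ch. 3 Thm. 4.2 (a), Thm. 5.1] -/
theorem of_namedLeaves :
    corollary627_splitOrUnramified → Varma2024.prop71_twoN →
      ArthurClozel1989_strongLifting_archimedean → ArthurClozel1989_strongLifting_cuspidal →
    ∀ (n : ℕ) (K : Type) [Field K] [NumberField K] (hcpt : isCompact_glFiniteIntegralLevel n K),
      (IsTotallyReal K ∨ IsCMField K) → ∀ (π : CuspidalAutomorphicRepData n K hcpt),
      π.1.IsRegularAlgebraic → ∀ (ℓ : ℕ) [Fact ℓ.Prime] (ι : PadicAlgCl ℓ ≃+* ℂ),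
      ∃ r : FramedGaloisRep K (PadicAlgCl ℓ) n, r.toGaloisRep.IsSemisimple ∧
        ∀ (v : HeightOneSpectrum (𝓞 K)) (α : Multiset ℂ), π.1.HasSatakeParamAt v α →
          ((ℓ : ℕ) : 𝓞 K) ∉ v.asIdeal →
            r.IsUnramifiedAt v ∧ r.HasFrobCharpolyAt v (arithFrobPolyOfSatake ι v.residueCard n α) :=
  fun h627 h71 harch hBC =>
    of_leaves_of_weilTraces h627 harch hBC fun hcpt hK π hπ ℓ _ ι r hr hc v hv α hα σ d _ hσ =>
      Varma2024.theorem1_unramified_traces_of_prop71 h71 harch hBC hcpt hK π hπ ℓ ι r hr hc v hv α hα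
        σ d hσ

end Summit.Langlands.Langlands.Theorems.GaloisRepOfRegularAlgebraic

end
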